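import Mathlib.RingTheory.MvPolynomial.Ideal
import Mathlib.RingTheory.MvPolynomial.Homogeneous
import Mathlib.Algebra.MvPolynomial.PDeriv
import Mathlib.Algebra.BigOperators.Fin
import HarnessLib

/-!
# The monomial complete intersection `(x₁ᵉ, …, x_mᵉ)`: membership, top degree, and Macaulay's bound

For a commutative semiring `R`, a finite set `σ` of `m` variables and `e : ℕ`, let
`J = (xᵢᵉ : i ∈ σ) ⊆ R[xᵢ : i ∈ σ]` — the Jacobian ideal of the Fermat form `Σ xᵢ^{e+1}` over a
field of characteristic prime to `e + 1`. This file PROVES the elementary case of Macaulay's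
theorem used at the Fermat point of the family of hypersurfaces (C. Voisin, *Hodge Theory and
Complex Algebraic Geometry II* (2003), Thm. 6.19 and Cor. 6.20: for the Jacobian ring `R_f = S/J_f`
of a smooth hypersurface, `N = Σ (deg ∂ᵢf - 1)`, "the map `μ : P ↦ μ_P, R^{b-a} → Hom(R^a, R^b)` is
injective for `b ≤ N`"), where everything is a statement about monomials:

* `mem_span_X_pow_iff` — `p ∈ J` iff every monomial `x^c` of `p` has some exponent `c i ≥ e`
  (Mathlib's `MvPolynomial.mem_ideal_span_monomial_image`);
* `mem_span_X_pow_of_lt_degree` — a form of degree `> m(e - 1)` lies in `J` (pigeonhole): the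
  quotient `S/J` vanishes above the socle degree `N = m(e - 1)` (Cor. 6.20 (i), Fermat case);
  `prod_X_pow_not_mem_span_X_pow` — `∏ xᵢ^{e-1} ∉ J` (the socle monomial, degree `N`);
* `exists_degree_eq_mul_monomial_not_mem_span_X_pow` — **Macaulay's bound for `J`**: if the
  form `p` of degree `a` is not in `J` and `a + b ≤ m(e - 1)`, some monomial `x^h` of degree `b` has
  `p · x^h ∉ J` (take `x^c ∉ J` in `p` and `h ≤ (e - 1 - cᵢ)ᵢ` of degree `b`; the coefficient of
  `x^{c+h}` in `p x^h` is that of `x^c` in `p`); hence `mem_span_X_pow_of_forall_mul_mem` —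
  **if `p · q ∈ J` for every form `q` of degree `b`, `a + b ≤ N`, then `p ∈ J`** (Cor. 6.20 (ii) in
  the form used in the proof of Thm. 6.24: "`μ_P = 0` if and only if `P = 0`"), and the socle
  statement `mem_span_X_pow_of_forall_X_mul_mem` (`b = 1`).

Pure combinatorics of exponents; no Koszul complexes. General complete intersections (Thm. 6.19 in
full) are not treated here. The last section identifies `J` with the Jacobian ideal of the Fermat
form: `(∂ⱼ Σᵢ xᵢ^{e+1} : j) = ((e+1) xⱼᵉ : j) = (xⱼᵉ : j)` when `e + 1` is a unit of `R`
(`span_pderiv_sum_X_pow_succ`), whence Macaulay's bound for the Jacobian ideal of the Fermat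
hypersurface of degree `d = e + 1` with `N = m(d - 2)` (`mem_span_pderiv_sum_X_pow_succ_of_forall_mul_mem`).

## References

* [VoisinHodgeII2003] C. Voisin, Hodge Theory and Complex Algebraic Geometry II, CUP 2003, §6.2.2
  Thm. 6.19, Cor. 6.20; §6.3.1 proof of Thm. 6.24.
* [Macaulay1916] F. S. Macaulay, The algebraic theory of modular systems, Cambridge 1916, §§ 70–72
  (inverse systems of `(x₁^{e}, …, x_m^{e})`).
-/

noncomputable section

namespace Literature.RingTheory.MvPolynomial

open _root_.MvPolynomial Finset

section MonomialCI

variable {R : Type*} [CommSemiring R] {σ : Type*}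

/-! ### Membership -/

/-- `(xᵢᵉ : i ∈ σ)` is the monomial ideal generated by the `x^{e·δᵢ}`. [folklore] -/
theorem span_X_pow_eq_span_monomial (e : ℕ) :
    Ideal.span (Set.range fun i : σ ↦ (X i : MvPolynomial σ R) ^ e) =
      Ideal.span ((fun s ↦ monomial s (1 : R)) '' Set.range fun i : σ ↦ Finsupp.single i e) := by
  congr 1
  ext p
  simp only [Set.mem_range, Set.mem_image, exists_exists_eq_and, X_pow_eq_monomial]

/-- **Membership in `(xᵢᵉ)`**: `p ∈ (xᵢᵉ : i ∈ σ)` iff every monomial in the support of `p` has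
some exponent `≥ e`. [folklore] -/
theorem mem_span_X_pow_iff {e : ℕ} {p : MvPolynomial σ R} :
    p ∈ Ideal.span (Set.range fun i : σ ↦ (X i : MvPolynomial σ R) ^ e) ↔
      ∀ c ∈ p.support, ∃ i, e ≤ c i := by
  rw [span_X_pow_eq_span_monomial, mem_ideal_span_monomial_image]
  refine forall₂_congr fun c _ ↦ ⟨?_, ?_⟩
  · rintro ⟨_, ⟨i, rfl⟩, hle⟩
    exact ⟨i, by simpa using hle i⟩
  · rintro ⟨i, hi⟩
    exact ⟨_, ⟨i, rfl⟩, Finsupp.single_le_iff.2 hi⟩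

/-- A monomial `a x^c`, `a ≠ 0`, lies in `(xᵢᵉ)` iff some `c i ≥ e`. [folklore] -/
theorem monomial_mem_span_X_pow_iff {e : ℕ} {c : σ →₀ ℕ} {a : R} (ha : a ≠ 0) :
    monomial c a ∈ Ideal.span (Set.range fun i : σ ↦ (X i : MvPolynomial σ R) ^ e) ↔
      ∃ i, e ≤ c i := by
  classical
  rw [mem_span_X_pow_iff, support_monomial, if_neg ha]
  simp

/-- `p ∉ (xᵢᵉ)` iff some monomial `x^c` of `p` has all exponents `< e`. [folklore] -/
theorem not_mem_span_X_pow_iff {e : ℕ} {p : MvPolynomial σ R} :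
    p ∉ Ideal.span (Set.range fun i : σ ↦ (X i : MvPolynomial σ R) ^ e) ↔
      ∃ c ∈ p.support, ∀ i, c i < e := by
  rw [mem_span_X_pow_iff]
  push Not
  rfl

/-- A monomial `x^c` of `p ∉ (xᵢᵉ)` with all exponents `< e`, together with the degree count
`Σ c i = a` for `p` homogeneous of degree `a`. [folklore] -/
theorem exists_coeff_ne_zero_of_not_mem_span_X_pow [Fintype σ] {e a : ℕ} {p : MvPolynomial σ R}
    (hp : p.IsHomogeneous a)
    (hpJ : p ∉ Ideal.span (Set.range fun i : σ ↦ (X i : MvPolynomial σ R) ^ e)) :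
    ∃ c : σ →₀ ℕ, coeff c p ≠ 0 ∧ (∀ i, c i < e) ∧ ∑ i, c i = a := by
  obtain ⟨c, hc, hce⟩ := not_mem_span_X_pow_iff.1 hpJ
  refine ⟨c, mem_support_iff.1 hc, hce, ?_⟩
  rw [← Finsupp.degree_eq_sum]
  have h := hp (mem_support_iff.1 hc)
  rw [Finsupp.degree_eq_weight_one]
  exact h

/-! ### The top degree `N = m (e - 1)` -/

/-- **`(S/J)_k = 0` for `k > m(e - 1)`** (Cor. 6.20 (i) at the Fermat point): a form of degree
`k > #σ · (e - 1)` lies in `(xᵢᵉ : i ∈ σ)` — a monomial of degree `k` with all exponents `≤ e - 1`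
would have degree `≤ #σ · (e - 1)`. [cite: VoisinHodgeII2003, Cor. 6.20 (i)] -/
theorem mem_span_X_pow_of_lt_degree [Fintype σ] {e k : ℕ} {p : MvPolynomial σ R}
    (hp : p.IsHomogeneous k) (hk : Fintype.card σ * (e - 1) < k) :
    p ∈ Ideal.span (Set.range fun i : σ ↦ (X i : MvPolynomial σ R) ^ e) := by
  by_contra hpJ
  obtain ⟨c, -, hce, hcsum⟩ := exists_coeff_ne_zero_of_not_mem_span_X_pow hp hpJ
  have hle : ∑ i, c i ≤ ∑ _i : σ, (e - 1) := Finset.sum_le_sum fun i _ ↦ by have := hce i; omega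
  rw [Finset.sum_const, Finset.card_univ, smul_eq_mul] at hle
  omega

/-- **The socle monomial `∏ xᵢ^{e-1}` is not in `(xᵢᵉ)`** (`R` non-trivial, `e ≥ 1`): `S/J` is
non-zero in the top degree `N = m(e - 1)`. [cite: VoisinHodgeII2003, Thm. 6.19] -/
theorem prod_X_pow_not_mem_span_X_pow [Fintype σ] [Nontrivial R] {e : ℕ} (he : 1 ≤ e) :
    (∏ i : σ, (X i : MvPolynomial σ R) ^ (e - 1)) ∉
      Ideal.span (Set.range fun i : σ ↦ (X i : MvPolynomial σ R) ^ e) := by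
  classical
  have hprod : (∏ i : σ, (X i : MvPolynomial σ R) ^ (e - 1)) =
      monomial (∑ i : σ, Finsupp.single i (e - 1)) 1 := by
    rw [monomial_sum_index, C_1, one_mul]
    exact Finset.prod_congr rfl fun i _ ↦ X_pow_eq_monomial
  rw [hprod, monomial_mem_span_X_pow_iff one_ne_zero]
  rintro ⟨i, hi⟩
  have h1 : (∑ j : σ, Finsupp.single j (e - 1)) i = e - 1 := by
    rw [Finsupp.coe_finsetSum, Finset.sum_apply,
      Finset.sum_eq_single i (fun j _ hji ↦ Finsupp.single_eq_of_ne' hji)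
        (fun h ↦ (h (Finset.mem_univ i)).elim),
      Finsupp.single_eq_same]
  omega

/-! ### Macaulay's bound -/

/-- Distributing `b` units into boxes of capacities `q i`, `i ∈ s`, when `b ≤ Σ q i`. [folklore] -/
theorem exists_le_sum_eq {ι : Type*} [DecidableEq ι] (s : Finset ι) (q : ι → ℕ) :
    ∀ b : ℕ, b ≤ ∑ i ∈ s, q i →
      ∃ h : ι → ℕ, (∀ i, h i ≤ q i) ∧ (∀ i ∉ s, h i = 0) ∧ ∑ i ∈ s, h i = b := by
  induction s using Finset.induction_on with
  | empty =>
    intro b hb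
    refine ⟨0, fun _ ↦ Nat.zero_le _, fun _ _ ↦ rfl, ?_⟩
    simp only [Finset.sum_empty] at hb ⊢
    omega
  | insert j s hj ih =>
    intro b hb
    rw [Finset.sum_insert hj] at hb
    by_cases hbs : b ≤ ∑ i ∈ s, q i
    · obtain ⟨h, hq, hz, hs⟩ := ih b hbs
      refine ⟨h, hq, fun i hi ↦ hz i fun his ↦ hi (Finset.mem_insert_of_mem his), ?_⟩
      rw [Finset.sum_insert hj, hz j hj, hs, zero_add]
    · push Not at hbs
      obtain ⟨h, hq, hz, hs⟩ := ih (∑ i ∈ s, q i) le_rfl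
      refine ⟨Function.update h j (b - ∑ i ∈ s, q i), fun i ↦ ?_, fun i hi ↦ ?_, ?_⟩
      · rcases eq_or_ne i j with rfl | hij
        · rw [Function.update_self]; omega
        · rw [Function.update_of_ne hij]; exact hq i
      · rw [Function.update_of_ne (fun hij ↦ hi (by rw [hij]; exact Finset.mem_insert_self j s))]
        exact hz i fun his ↦ hi (Finset.mem_insert_of_mem his)
      · rw [Finset.sum_insert hj, Function.update_self]
        have hsum : ∑ i ∈ s, Function.update h j (b - ∑ i ∈ s, q i) i = ∑ i ∈ s, h i :=
          Finset.sum_congr rfl fun i hi ↦ by rw [Function.update_of_ne (ne_of_mem_of_not_mem hi hj)]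
        rw [hsum, hs]
        exact Nat.sub_add_cancel hbs.le

/-- **Macaulay's bound for the monomial complete intersection `(xᵢᵉ : i ∈ σ)`** (the Fermat case
of Voisin II, Cor. 6.20 (ii): injectivity of `P ↦ μ_P`, `R^{a} → Hom(R^b, R^{a+b})` for
`a + b ≤ N = m(e - 1)`): if the form `p` of degree `a` is not in `J` and `a + b ≤ #σ · (e - 1)`,
then `p · x^h ∉ J` for some monomial `x^h` of degree `b`. Proof: pick a monomial `x^c` of `p`
with all `c i ≤ e - 1` (`not_mem_span_X_pow_iff`); as `Σ (e - 1 - c i) = N - a ≥ b` there is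
`h ≤ (e - 1 - c i)ᵢ` of degree `b` (`exists_le_sum_eq`); the coefficient of `x^{c+h}` in `p x^h`
is the coefficient of `x^c` in `p` (`coeff_mul_monomial`), and all exponents of `c + h` are
`≤ e - 1`. [cite: VoisinHodgeII2003, Cor. 6.20 (ii) and Thm. 6.19] -/
theorem exists_degree_eq_mul_monomial_not_mem_span_X_pow [Fintype σ] {e a b : ℕ}
    {p : MvPolynomial σ R} (hp : p.IsHomogeneous a)
    (hpJ : p ∉ Ideal.span (Set.range fun i : σ ↦ (X i : MvPolynomial σ R) ^ e))
    (hab : a + b ≤ Fintype.card σ * (e - 1)) :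
    ∃ h : σ →₀ ℕ, h.degree = b ∧
      p * monomial h 1 ∉ Ideal.span (Set.range fun i : σ ↦ (X i : MvPolynomial σ R) ^ e) := by
  classical
  obtain ⟨c, hc, hce, hcsum⟩ := exists_coeff_ne_zero_of_not_mem_span_X_pow hp hpJ
  -- capacities `e - 1 - c i`, of total `N - a ≥ b`
  have hcap : b ≤ ∑ i ∈ (Finset.univ : Finset σ), (e - 1 - c i) := by
    have h1 : ∑ i ∈ (Finset.univ : Finset σ), (e - 1 - c i) + ∑ i, c i =
        Fintype.card σ * (e - 1) := by
      rw [← Finset.sum_add_distrib, Finset.sum_congr rfl fun i _ ↦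
        (Nat.sub_add_cancel (Nat.le_sub_one_of_lt (hce i)) : e - 1 - c i + c i = e - 1)]
      simp
    omega
  obtain ⟨h, hq, -, hs⟩ := exists_le_sum_eq (Finset.univ : Finset σ) (fun i ↦ e - 1 - c i) b hcap
  refine ⟨Finsupp.equivFunOnFinite.symm h, ?_, ?_⟩
  · rw [Finsupp.degree_eq_sum]
    simpa [Finsupp.coe_equivFunOnFinite_symm] using hs
  · rw [not_mem_span_X_pow_iff]
    refine ⟨c + Finsupp.equivFunOnFinite.symm h, ?_, fun i ↦ ?_⟩
    · rw [mem_support_iff, coeff_mul_monomial, mul_one]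
      exact hc
    · have h1 := hq i
      have h2 := hce i
      simp only [Finsupp.coe_add, Pi.add_apply, Finsupp.coe_equivFunOnFinite_symm]
      omega

/-- **Cor. 6.20 (ii) at the Fermat point, contrapositive form**: if `a + b ≤ #σ · (e - 1)` and
`p · q ∈ (xᵢᵉ)` for every form `q` of degree `b`, then the form `p` of degree `a` lies in `(xᵢᵉ)`
("`μ_P = 0` if and only if `P = 0`" in `R = S/J`, proof of Thm. 6.24).
[cite: VoisinHodgeII2003, Cor. 6.20 (ii) and proof of Thm. 6.24] -/
theorem mem_span_X_pow_of_forall_mul_mem [Fintype σ] {e a b : ℕ} {p : MvPolynomial σ R}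
    (hp : p.IsHomogeneous a) (hab : a + b ≤ Fintype.card σ * (e - 1))
    (H : ∀ q : MvPolynomial σ R, q.IsHomogeneous b →
      p * q ∈ Ideal.span (Set.range fun i : σ ↦ (X i : MvPolynomial σ R) ^ e)) :
    p ∈ Ideal.span (Set.range fun i : σ ↦ (X i : MvPolynomial σ R) ^ e) := by
  by_contra hpJ
  obtain ⟨h, hh, hnot⟩ := exists_degree_eq_mul_monomial_not_mem_span_X_pow hp hpJ hab
  exact hnot (H _ (isHomogeneous_monomial _ hh))

/-- **The socle of `S/(xᵢᵉ)` is concentrated in the top degree**: a form of degree `a < #σ · (e - 1)`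
with `xᵢ · p ∈ (xᵢᵉ)` for all `i` lies in `(xᵢᵉ)`: a monomial `x^c ∉ J` of `p` has some
`c i < e - 1` (degree count), and then `x^{c + δᵢ}` is a monomial of `xᵢ p` outside `J`.
[cite: VoisinHodgeII2003, Thm. 6.19] -/
theorem mem_span_X_pow_of_forall_X_mul_mem [Fintype σ] {e a : ℕ} {p : MvPolynomial σ R}
    (hp : p.IsHomogeneous a) (ha : a < Fintype.card σ * (e - 1))
    (H : ∀ i : σ, X i * p ∈ Ideal.span (Set.range fun i : σ ↦ (X i : MvPolynomial σ R) ^ e)) :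
    p ∈ Ideal.span (Set.range fun i : σ ↦ (X i : MvPolynomial σ R) ^ e) := by
  by_contra hpJ
  obtain ⟨c, hc, hce, hcsum⟩ := exists_coeff_ne_zero_of_not_mem_span_X_pow hp hpJ
  -- some exponent is `< e - 1`, since `Σ c i = a < #σ (e - 1)`
  obtain ⟨i, hi⟩ : ∃ i, c i < e - 1 := by
    by_contra hne
    push Not at hne
    have hle : ∑ _i : σ, (e - 1) ≤ ∑ i, c i := Finset.sum_le_sum fun i _ ↦ hne i
    rw [Finset.sum_const, Finset.card_univ, smul_eq_mul] at hle
    omega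
  refine (not_mem_span_X_pow_iff.2 ⟨Finsupp.single i 1 + c, ?_, fun j ↦ ?_⟩) (H i)
  · rw [mem_support_iff, X, coeff_monomial_mul, one_mul]
    exact hc
  · have h2 := hce j
    simp only [Finsupp.coe_add, Pi.add_apply]
    rcases eq_or_ne i j with rfl | hij
    · rw [Finsupp.single_eq_same]; omega
    · rw [Finsupp.single_eq_of_ne' hij]; omega

/-! ### The Jacobian ideal of the Fermat form -/

/-- `∂ⱼ (Σᵢ xᵢ^{e+1}) = (e + 1) xⱼᵉ`. [folklore] -/
theorem pderiv_sum_X_pow_succ [Fintype σ] (j : σ) (e : ℕ) :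
    pderiv j (∑ i : σ, (X i : MvPolynomial σ R) ^ (e + 1)) =
      ((e + 1 : ℕ) : MvPolynomial σ R) * X j ^ e := by
  classical
  rw [map_sum, Finset.sum_eq_single j (fun i _ hij ↦ by
      rw [Derivation.leibniz_pow, pderiv_X_of_ne hij, smul_zero, smul_zero])
    (fun h ↦ (h (Finset.mem_univ j)).elim), Derivation.leibniz_pow, pderiv_X_self]
  simp [nsmul_eq_mul]

/-- **The Jacobian ideal of the Fermat form is the monomial complete intersection**:
`(∂ⱼ Σᵢ xᵢ^{e+1} : j ∈ σ) = (xⱼᵉ : j ∈ σ)` as soon as `e + 1` is a unit of `R` (e.g. `R` a field of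
characteristic `0`). [cite: VoisinHodgeII2003, §6.2.2 (R_f = S/J_f) and Cor. 6.20] -/
theorem span_pderiv_sum_X_pow_succ [Fintype σ] (e : ℕ) (hu : IsUnit ((e + 1 : ℕ) : R)) :
    Ideal.span (Set.range fun j : σ ↦ pderiv j (∑ i : σ, (X i : MvPolynomial σ R) ^ (e + 1))) =
      Ideal.span (Set.range fun i : σ ↦ (X i : MvPolynomial σ R) ^ e) := by
  have hu' : IsUnit ((e + 1 : ℕ) : MvPolynomial σ R) := by
    simpa using hu.map (C : R →+* MvPolynomial σ R)
  apply le_antisymm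
  · rw [Ideal.span_le]
    rintro _ ⟨j, rfl⟩
    change pderiv j (∑ i : σ, (X i : MvPolynomial σ R) ^ (e + 1)) ∈ _
    rw [pderiv_sum_X_pow_succ]
    exact Ideal.mul_mem_left _ _ (Ideal.subset_span ⟨j, rfl⟩)
  · rw [Ideal.span_le]
    rintro _ ⟨j, rfl⟩
    change (X j : MvPolynomial σ R) ^ e ∈ _
    have h : pderiv j (∑ i : σ, (X i : MvPolynomial σ R) ^ (e + 1)) ∈
        Ideal.span (Set.range fun j : σ ↦ pderiv j (∑ i : σ, (X i : MvPolynomial σ R) ^ (e + 1))) :=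
      Ideal.subset_span ⟨j, rfl⟩
    rw [pderiv_sum_X_pow_succ] at h
    exact (Ideal.unit_mul_mem_iff_mem _ hu').1 h

/-- **Macaulay's bound for the Jacobian ideal of the Fermat hypersurface** `Σᵢ xᵢᵈ = 0`,
`d = e + 1` a unit of `R`, in `m = #σ` variables, `N = m(d - 2)`: if `a + b ≤ N` and `p · q ∈ J`
for every form `q` of degree `b`, then the form `p` of degree `a` lies in `J` — Cor. 6.20 (ii)
("`μ_P = 0` if and only if `P = 0`", proof of Thm. 6.24) at the Fermat point, by pure
combinatorics. [cite: VoisinHodgeII2003, Cor. 6.20 (ii) and proof of Thm. 6.24] -/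
theorem mem_span_pderiv_sum_X_pow_succ_of_forall_mul_mem [Fintype σ] {e a b : ℕ}
    (hu : IsUnit ((e + 1 : ℕ) : R)) {p : MvPolynomial σ R} (hp : p.IsHomogeneous a)
    (hab : a + b ≤ Fintype.card σ * (e - 1))
    (H : ∀ q : MvPolynomial σ R, q.IsHomogeneous b →
      p * q ∈ Ideal.span (Set.range fun j : σ ↦ pderiv j (∑ i : σ, (X i : MvPolynomial σ R) ^ (e + 1)))) :
    p ∈ Ideal.span (Set.range fun j : σ ↦ pderiv j (∑ i : σ, (X i : MvPolynomial σ R) ^ (e + 1))) := by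
  rw [span_pderiv_sum_X_pow_succ e hu] at H ⊢
  exact mem_span_X_pow_of_forall_mul_mem hp hab H

/-- Above the socle degree the Jacobian ring of the Fermat form vanishes: a form of degree
`k > m(d - 2)` lies in `(∂ⱼ Σ xᵢᵈ)` (`d = e + 1` a unit). [cite: VoisinHodgeII2003, Cor. 6.20 (i)] -/
theorem mem_span_pderiv_sum_X_pow_succ_of_lt_degree [Fintype σ] {e k : ℕ}
    (hu : IsUnit ((e + 1 : ℕ) : R)) {p : MvPolynomial σ R} (hp : p.IsHomogeneous k)
    (hk : Fintype.card σ * (e - 1) < k) :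
    p ∈ Ideal.span (Set.range fun j : σ ↦ pderiv j (∑ i : σ, (X i : MvPolynomial σ R) ^ (e + 1))) := by
  rw [span_pderiv_sum_X_pow_succ e hu]
  exact mem_span_X_pow_of_lt_degree hp hk

end MonomialCI

end Literature.RingTheory.MvPolynomial

end
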